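import Literature.AnabelianGeometry.EtaleTheta.TemperedFrobenioidProps
import Literature.AnabelianGeometry.EtaleTheta.TemperedFrobenioidToy
import Literature.AlgebraicGeometry.Frobenioids.ModelFrobenioidNotSlim
import HarnessLib

/-!
# [EtTh] Theorem 3.7 (iv) "`D` slim ⟹ `C` slim": the closure of the typed `Thm37_iv` OVER THE INTERFACE
# `TemperedFrobenioid` is false — a degenerate inhabitant with divisible units (FACT-LIST F-0744)

S. Mochizuki, *The étale theta function …*, Publ. RIMS **45** (2009) [EtTh], §3, Theorem 3.7 (iv), PDF p. 80
[cite: MochizukiEtTh2009, Thm 3.7 p.80]: "If `D` is slim, and `Λ ∈ {ℤ, ℝ}`, then `C` is also slim", proved in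
print "formally from [FrdI], Proposition 1.13, (iii) [since, by assertion (i), condition (b) of loc. cit. is
always satisfied by objects of `C`]" — i.e. THROUGH Thm 3.7 (i) "`C` is of unit-profinite type" (`Λ = ℤ`), which
gives `⋂ₙ O^×(A)ⁿ = {1}`.

PROOF-ONLY companion (no definitions) of abc-iut-L2-t3's `TemperedFrobenioidProps.lean` (FACT-LIST row **F-0744**
`TemperedFrobenioid.Thm37_iv`, `preparatory`, status `conditional`), abc-iut cell seat abc-iut-f-049.

KERNEL VERDICT ON THE CLOSURE.  The typed `Thm37_iv C₀` quantifies over every inhabitant `C₀` of the INTERFACE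
`TemperedFrobenioid T D VD` (Def 3.6 (i)/(ii) as a structure: the data `B₀^Λ` is an ARBITRARY group-like monoid
functor with a homomorphism to `(Φ₀^ℝ)^gp`; nothing records that `B₀` is a monoid of meromorphic FUNCTIONS, whose
divisor-free part is a group of roots of unity / is unit-profinite).  `not_forall_thm37_iv`: over the one-object
base `D = D₀` (slim) take abc-iut-L2-t3's degenerate Toy data (`TemperedFrobenioidToy.lean`: `Φ₀ = Φ = ℕ`,
`Λ = ℤ`) with `B₀^Λ := ℤ × ℚ`, `div(m, q) := m · 𝔭` — every interface field holds as for the Toy — so that the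
rational-function monoid `B = B₀^Λ ×_{(Φ^{ℝ-log})^gp} Φ^gp` of the model Frobenioid `C` contains the `Div_B`-trivial
DIVISIBLE group `0 × ℚ × 1`; the root system `rₙ := (0, 1/n, 1)` then makes `C` NON-slim by the [FrdI] Remark 1.13.1
mechanism for model Frobenioids (`ModelFrobenioid.not_isSlim_of_rootFamily`, abc-iut-f-049), although `D` is slim
and `Λ = ℤ`.  So the universal closure of F-0744 is FALSE: the interface does not carry the content of Thm 3.7 (i)
that print's proof of (iv) uses.

INSTANCE FORMS (what print proves) are in the tree and are CITED, not restated: `Thm37_iv` modulo `hF` ([FrdI]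
Thm 5.2 (ii)) and `hdiv` (`⋂ₙ O^×(A)ⁿ = 1`) — `TemperedFrobenioid.thm37_iv_of_isFrobenioid`; at the canonical
vocabulary modulo `hBmon`, `hdiv` — `thm37_iv_treeCatVocab_of_isMonoidOn` (`Discharge/Sec3Thm37Holds.lean`,
abc-iut-L6-t13); `hdiv` from unit-profiniteness — `Discharge/Sec3Thm37UnitProfinite.lean`.  Hence F-0744 is
admissible AT NAMED INSTANCES ONLY, and its honest hypothesis of record is `hdiv`.  HONEST FRAMING: a statement
about the typed interface, not about [EtTh] (whose tempered Frobenioids do satisfy (b)); nothing here bears on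
[IUTchIII] Cor. 3.12.
-/

namespace Literature.AnabelianGeometry.EtaleTheta

open CategoryTheory Opposite Literature.AlgebraicGeometry.Frobenioids

namespace TemperedFrobenioid

/-- **The universal closure of F-0744 is false**: there is an inhabitant `C₀` of the tempered-Frobenioid
interface over the slim one-object base, of monoid type `Λ = ℤ`, whose category is NOT slim (`B₀^Λ = ℤ × ℚ`:
the units `(0, 1/n)` form a `Div_B`-trivial root system, [FrdI] Rmk 1.13.1). The printed Thm 3.7 (iv) is the
instance form `thm37_iv_of_isFrobenioid` under `hdiv : ⋂ₙ O^×(A)ⁿ = 1`. [cite: MochizukiEtTh2009, Thm 3.7 p.80] -/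
theorem not_forall_thm37_iv :
    ¬ ∀ (D₀ : Type) (_ : Category.{0} D₀) (V : FrdIMonoidStub.{0}) (T : RealifiedDivisorMonoids (D₀ := D₀) V)
        (D : Type) (_ : Category.{0} D) (VD : FrdICatStub.{0, 0, 0} D) (C₀ : TemperedFrobenioid T D VD),
        C₀.Thm37_iv := by
  intro h
  -- the variant of the Toy data: `B₀^Λ := ℤ × ℚ`, `div(m, q) := 𝔭^m`
  let T : RealifiedDivisorMonoids (D₀ := Discrete PUnit.{1}) Toy.monoidVocab :=
    { Toy.realified with
      BΛ := (Functor.const _).obj (CommMonCat.of (Multiplicative (ℤ × ℚ)))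
      isUnit_BΛ := fun _ b => by
        change IsUnit (M := Multiplicative (ℤ × ℚ)) b
        exact Group.isUnit _
      divΛ := fun _ => Toy.divHom.comp (AddMonoidHom.fst ℤ ℚ).toMultiplicative
      divΛ_natural := fun _ b => (DFunLike.congr_fun (gpMap_id (M := Multiplicative ℕ)) _).symm
      FΛ := fun _ => ⊤
      FΛ_map := fun _ _ _ => trivial
      divΛ_mem_cnstR := fun _ _ _ => trivial }
  let C₀ : TemperedFrobenioid T (Discrete PUnit.{1}) Toy.catVocab :=
    { isConnected := Toy.temperedFrobenioid.isConnected
      isTotallyEpimorphic := Toy.temperedFrobenioid.isTotallyEpimorphic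
      base := 𝟭 _
      Φ := ⟨fun _ => ⊤, fun _ _ _ => trivial⟩
      isGroupSaturated := Toy.temperedFrobenioid.isGroupSaturated
      isPerfFactorial := fun _ => trivial
      isDivisorialOn := trivial
      isMonoprime_bsFld := Toy.temperedFrobenioid.isMonoprime_bsFld
      exists_FΛ_div_ne := fun A => ⟨Multiplicative.ofAdd ((1 : ℤ), (0 : ℚ)), trivial,
        (Multiplicative.ofAdd (1 : ℕ) : Multiplicative ℕ), trivial, (1 : Multiplicative ℕ), trivial,
        fun h => Nat.one_ne_zero (Multiplicative.ofAdd.injective h),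
        Toy.divHom_ofAdd_one.trans (by
          change Algebra.GrothendieckGroup.of (M := Multiplicative ℕ) (Multiplicative.ofAdd 1) =
            Algebra.GrothendieckGroup.of (M := Multiplicative ℕ) (Multiplicative.ofAdd 1) /
              Algebra.GrothendieckGroup.of (M := Multiplicative ℕ) 1
          rw [(Algebra.GrothendieckGroup.of (M := Multiplicative ℕ)).map_one, div_one])⟩ }
  have hslimD : IsSlim (Discrete PUnit.{1}) :=
    ⟨fun _ _ => Iso.ext (NatTrans.ext (funext fun _ => Subsingleton.elim _ _))⟩
  have hC : IsSlim C₀.category :=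
    h (Discrete PUnit.{1}) inferInstance Toy.monoidVocab T (Discrete PUnit.{1}) inferInstance Toy.catVocab C₀
      hslimD (Or.inl rfl)
  -- the root system `rₙ := ((0, 1/n), 1) ∈ B = B₀^Λ ×_{(Φ^{ℝ-log})^gp} Φ^gp`
  have mem : ∀ (q : ℚ) (X : (Discrete PUnit.{1})ᵒᵖ),
      ((Multiplicative.ofAdd ((0 : ℤ), q), (1 : Algebra.GrothendieckGroup (C₀.Φ.carrier X))) :
        (T.BΛ.obj (C₀.baseOp X) : Type) × Algebra.GrothendieckGroup (C₀.Φ.carrier X)) ∈ C₀.ratFn X := by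
    intro q X
    change Toy.divHom 1 = C₀.ΦgpToRlog X 1
    rw [map_one, map_one]
    rfl
  refine ModelFrobenioid.not_isSlim_of_rootFamily (Φ := C₀.divisorMonoid) (B := C₀.ratFnFunctor)
    (DivB := C₀.divBNatTrans)
    (fun n X => ⟨_, mem (((n : ℕ) : ℚ))⁻¹ X⟩) (fun n X => ⟨_, mem (-(((n : ℕ) : ℚ))⁻¹) X⟩)
    ?_ ?_ (fun _ _ => rfl) ?_ (X₀ := ⟨PUnit.unit⟩) ?_ hC
  · -- `rₙ · rₙ⁻¹ = 1`
    intro n X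
    apply Subtype.ext
    apply Prod.ext
    · change Multiplicative.ofAdd ((0 : ℤ), (((n : ℕ) : ℚ))⁻¹) * Multiplicative.ofAdd ((0 : ℤ), -(((n : ℕ) : ℚ))⁻¹) =
        Multiplicative.ofAdd (0 : ℤ × ℚ)
      rw [← ofAdd_add, Prod.mk_add_mk, add_zero, add_neg_cancel, Prod.mk_zero_zero]
    · exact mul_one _
  · -- naturality: the pull-backs of `B` act trivially on the first component and by a homomorphism on `1`
    intro n X Y f
    apply Subtype.ext
    apply Prod.ext
    · rfl
    · change gpMap (C₀.Φ.pull f) 1 = 1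
      exact map_one _
  · -- root system: `r_{n·k}^k = rₙ`
    intro n k X
    apply Subtype.ext
    change ((Multiplicative.ofAdd ((0 : ℤ), ((((n * k : ℕ+) : ℕ) : ℚ))⁻¹),
        (1 : Algebra.GrothendieckGroup (C₀.Φ.carrier X))) : Multiplicative (ℤ × ℚ) × _) ^ (k : ℕ) =
      (Multiplicative.ofAdd ((0 : ℤ), (((n : ℕ) : ℚ))⁻¹), (1 : Algebra.GrothendieckGroup (C₀.Φ.carrier X)))
    apply Prod.ext
    · change Multiplicative.ofAdd ((0 : ℤ), ((((n * k : ℕ+) : ℕ) : ℚ))⁻¹) ^ (k : ℕ) =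
        Multiplicative.ofAdd ((0 : ℤ), (((n : ℕ) : ℚ))⁻¹)
      rw [← ofAdd_nsmul, Prod.smul_mk, smul_zero, nsmul_eq_mul, PNat.mul_coe, Nat.cast_mul, mul_inv,
        mul_comm ((((n : ℕ) : ℚ))⁻¹), ← mul_assoc,
        mul_inv_cancel₀ (Nat.cast_ne_zero.mpr (PNat.ne_zero k)), one_mul]
    · change (1 : Algebra.GrothendieckGroup (C₀.Φ.carrier X)) ^ (k : ℕ) = 1
      exact one_pow _
  · -- `r₁ ≠ 1`
    intro h1
    have h2 := congrArg (fun p : C₀.ratFn (op ⟨PUnit.unit⟩) => (Multiplicative.toAdd p.1.1).2) h1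
    change ((((1 : ℕ+) : ℕ) : ℚ))⁻¹ = (0 : ℚ) at h2
    rw [PNat.one_coe, Nat.cast_one, inv_one] at h2
    exact one_ne_zero h2

end TemperedFrobenioid

end Literature.AnabelianGeometry.EtaleTheta
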